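import Mathlib
import HarnessLib
import Literature.Analysis.FluidPDE.TypeIAncientMild
import Literature.Analysis.FluidPDE.KatoLocalBoundedPicard
import Literature.Analysis.FluidPDE.NSBoundedMildOseenRestart
import Literature.Analysis.FluidPDE.ForcedOseenMildPeriodic
import Literature.Analysis.FluidPDE.NSBoundedMildSmoothing
import Literature.Analysis.UnboundedOperators.HeatKernelBoundedData
import Summits.NavierStokesRegularity.NavierStokesRegularity.Theorems.QuarterLogPincerQuietCollarDefs
import Summits.NavierStokesRegularity.NavierStokesRegularity.Theorems.QuarterLogPincerTruncationEdgeOseenStability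

/-!
# Route `QuarterLogPincer`, crux `TypeIQuantSubcubicExp` (stmt-NavierStokesRegularity-24077), line `quiet_collar` — towards QP3
# `stub_forcedTwoNormShadowing`: THE MILD DEFECT RESTARTED FROM AN INTERMEDIATE TIME

QP3 measures a reference `V` by its MILD DEFECT from time `0`, `mildDefect V t = V t − e^{tΔ}V(0) + B₀(V,V)(t)`
(`Theorems/QuarterLogPincerQuietCollarDefs.lean`).  The `L^∞` stability chain `…QuietCollarQuasiMildStability` restarts at every
base time `s`, so it needs the defect FROM `s`: this file proves that for `V` jointly continuous and bounded on the slab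
`[0,T] × ℝ³`,

  `V(t) = e^{(t−s)Δ}V(s) − B_s(V,V)(t) + (mildDefect V t − e^{(t−s)Δ}(mildDefect V s))`,  `0 ≤ s < t ≤ T`

(`quasiMild_of_mildDefect`: the restart law of the Duhamel term — `oseenDuhamel_eq_setIntegral_add_oseenDuhamel` +
`heatExtension_oseenDuhamel_eq_setIntegral` (`NSBoundedMildOseenRestart`) — the heat semigroup
`heatExtension_add_holds`, and linearity of the heat extension on bounded continuous data), hence the defect from every base time is
bounded by TWICE the defect from `0` (`norm_mildDefect_restart_le`).  Tools only; HONEST FRAME: bookkeeping about a hypothetical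
reference field; nothing here bears on 24077, W7 or Navier–Stokes regularity (OPEN).  Helper of the pub-ns-dss typer (g36).
-/

noncomputable section

set_option linter.dupNamespace false

namespace Summit.NavierStokesRegularity.NavierStokesRegularity.Cruxes.TypeIQuantSubcubicExp.QuietCollar

open MeasureTheory Set Function Filter Real Metric
open scoped ENNReal NNReal Topology
open Literature.Analysis Literature.Analysis.FluidPDE
open Summit.NavierStokesRegularity.NavierStokesRegularity.Theorems.QuarterLogPincerTruncationEdge
  (continuous_slice_of_continuousOn_slab aestronglyMeasurable_of_continuousOn_slab)

variable {V : ℝ → EuclideanSpace ℝ (Fin 3) → EuclideanSpace ℝ (Fin 3)} {T U η : ℝ}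

/-- `mildDefect V 0 = 0` (`e^{0Δ} = id`, empty Duhamel integral). [folklore] -/
theorem mildDefect_zero (V : ℝ → EuclideanSpace ℝ (Fin 3) → EuclideanSpace ℝ (Fin 3)) (x : EuclideanSpace ℝ (Fin 3)) :
    mildDefect V 0 x = 0 := by
  simp [mildDefect, heatFlow_zero, oseenDuhamel_apply]

/-- The Duhamel term of `V` from `0` is bounded on the slab: `‖B₀(V,V)(t)‖ ≤ C U² · 2√t`. [folklore] -/
theorem exists_norm_oseenDuhamel_slab_le (hT : 0 < T) (hU : 0 ≤ U) (hVU : ∀ t ∈ Icc 0 T, ∀ x, ‖V t x‖ ≤ U) :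
    ∃ CB : ℝ, 0 ≤ CB ∧ ∀ s ∈ Ioc 0 T, ∀ x, ‖oseenDuhamel 1 0 V V s x‖ ≤ CB := by
  obtain ⟨C, hC, hB⟩ := exists_norm_oseenDuhamel_le_mul (E := EuclideanSpace ℝ (Fin 3))
  refine ⟨C * U * U * (2 * Real.sqrt T), by positivity, fun s hs x => ?_⟩
  have h := hB one_pos hs.1 hU hU (fun τ hτ y => hVU τ ⟨hτ.1.le, hτ.2.le.trans hs.2⟩ y)
    (fun τ hτ y => hVU τ ⟨hτ.1.le, hτ.2.le.trans hs.2⟩ y) x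
  simp only [Real.one_rpow, mul_one, sub_zero] at h
  refine h.trans ?_
  gcongr
  exact hs.2

/-- The Duhamel slice `B₀(V,V)(s,·)` is continuous for `0 < s ≤ T`. [folklore] -/
theorem continuous_oseenDuhamel_slab (hVc : ContinuousOn (uncurry V) (Icc 0 T ×ˢ univ)) (hU : 0 ≤ U)
    (hVU : ∀ t ∈ Icc 0 T, ∀ x, ‖V t x‖ ≤ U) {s : ℝ} (hs : s ∈ Ioc 0 T) :
    Continuous (oseenDuhamel 1 0 V V s) :=
  continuous_oseenDuhamel_slice one_pos hU (aestronglyMeasurable_of_continuousOn_slab hVc le_rfl le_rfl)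
    (aestronglyMeasurable_of_continuousOn_slab hVc le_rfl le_rfl)
    (fun τ hτ y => hVU τ ⟨hτ.1.le, hτ.2.le⟩ y) (fun τ hτ y => hVU τ ⟨hτ.1.le, hτ.2.le⟩ y) hs.1 hs.2

/-- The mild defect slice is continuous for `0 < s ≤ T`. [folklore] -/
theorem continuous_mildDefect_slice (hVc : ContinuousOn (uncurry V) (Icc 0 T ×ˢ univ)) (hU : 0 ≤ U)
    (hVU : ∀ t ∈ Icc 0 T, ∀ x, ‖V t x‖ ≤ U) {s : ℝ} (hs : s ∈ Ioc 0 T) :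
    Continuous (mildDefect V s) := by
  have h1 : Continuous (V s) := continuous_slice_of_continuousOn_slab hVc ⟨hs.1.le, hs.2⟩
  have h2 : Continuous (heatFlow (V 0) s) := by
    rw [heatFlow_of_pos _ hs.1]
    exact (UnboundedOperators.contDiff_heatExtension_of_bound (m := 0)
      (continuous_slice_of_continuousOn_slab hVc ⟨le_rfl, (hs.1.le.trans hs.2)⟩)
      (fun z => hVU 0 ⟨le_rfl, hs.1.le.trans hs.2⟩ z) hs.1).continuous
  have h3 := continuous_oseenDuhamel_slab hVc hU hVU hs
  have : mildDefect V s = fun x => V s x - heatFlow (V 0) s x + oseenDuhamel 1 0 V V s x := rfl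
  rw [this]
  exact (h1.sub h2).add h3

/-- **THE RESTARTED DEFECT IDENTITY.**  For `V` jointly continuous and bounded by `U` on `[0,T] × ℝ³` and `0 ≤ s < t ≤ T`:
`V(t) = e^{(t−s)Δ}V(s) − B_s(V,V)(t) + (mildDefect V t − e^{(t−s)Δ}(mildDefect V s))` — the restart law of the Duhamel term plus the
heat semigroup and linearity on bounded continuous slices. [folklore; KNSS 2009 §4 p. 8 (restart of the integral equation)] -/
theorem quasiMild_of_mildDefect (hT : 0 < T) (hVc : ContinuousOn (uncurry V) (Icc 0 T ×ˢ univ)) (hU : 0 ≤ U)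
    (hVU : ∀ t ∈ Icc 0 T, ∀ x, ‖V t x‖ ≤ U)
    {s t : ℝ} (hs : 0 ≤ s) (hst : s < t) (htT : t ≤ T) (x : EuclideanSpace ℝ (Fin 3)) :
    V t x = heatFlow (V s) (t - s) x - oseenDuhamel 1 s V V t x +
      (mildDefect V t x - heatFlow (mildDefect V s) (t - s) x) := by
  rcases hs.eq_or_lt with h0 | hs0
  · -- base time `0`: the definition of the defect
    subst h0
    have hz : heatFlow (mildDefect V 0) (t - 0) x = 0 := by
      rw [show mildDefect V 0 = fun _ => (0 : EuclideanSpace ℝ (Fin 3)) from funext (mildDefect_zero V), sub_zero,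
        heatFlow_of_pos _ hst, UnboundedOperators.heatExtension_const _ hst]
    rw [hz]
    simp only [mildDefect, sub_zero]
    abel
  -- `0 < s < t`: restart
  have hts : 0 < t - s := sub_pos.2 hst
  have ht0 : 0 < t := hs0.trans hst
  -- the slab-truncated field (jointly measurable) agrees with `V` on `(0,T)`
  set W : ℝ → EuclideanSpace ℝ (Fin 3) → EuclideanSpace ℝ (Fin 3) :=
    fun τ y => (Ioo (0:ℝ) T ×ˢ (univ : Set (EuclideanSpace ℝ (Fin 3)))).piecewise (uncurry V) (fun _ => 0) (τ, y) with hW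
  have hWm : Measurable (uncurry W) := by
    have : uncurry W = (Ioo (0:ℝ) T ×ˢ (univ : Set (EuclideanSpace ℝ (Fin 3)))).piecewise (uncurry V) (fun _ => 0) := by
      funext p; rfl
    rw [this]
    exact (hVc.mono (prod_mono Ioo_subset_Icc_self subset_rfl)).measurable_piecewise continuousOn_const
      (measurableSet_Ioo.prod MeasurableSet.univ)
  have hWV : ∀ τ ∈ Ioo (0:ℝ) T, W τ = V τ := by
    intro τ hτ; funext y
    exact Set.piecewise_eq_of_mem _ _ _ (mem_prod.2 ⟨hτ, mem_univ y⟩)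
  have hWU : ∀ τ y, ‖W τ y‖ ≤ U := fun τ y => by
    by_cases hτ : τ ∈ Ioo (0:ℝ) T
    · rw [hWV τ hτ]; exact hVU τ ⟨hτ.1.le, hτ.2.le⟩ y
    · have : W τ y = 0 := Set.piecewise_eq_of_notMem _ _ _ (fun h => hτ (mem_prod.1 h).1)
      rw [this, norm_zero]; exact hU
  have hB0W : ∀ r ∈ Ioc (0:ℝ) T, ∀ y, oseenDuhamel 1 0 V V r y = oseenDuhamel 1 0 W W r y := fun r hr y =>
    oseenDuhamel_congr_of_eqOn_Ioo (fun τ hτ => (hWV τ ⟨hτ.1, hτ.2.trans_le hr.2⟩).symm)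
      (fun τ hτ => (hWV τ ⟨hτ.1, hτ.2.trans_le hr.2⟩).symm) y
  have hBsW : ∀ y, oseenDuhamel 1 s V V t y = oseenDuhamel 1 s W W t y := fun y =>
    oseenDuhamel_congr_of_eqOn_Ioo (fun τ hτ => (hWV τ ⟨hs0.trans hτ.1, hτ.2.trans_le htT⟩).symm)
      (fun τ hτ => (hWV τ ⟨hs0.trans hτ.1, hτ.2.trans_le htT⟩).symm) y
  -- the restart law for `B₀(W,W)` (KNSS 2009 §4 p. 8)
  have hrestart : oseenDuhamel 1 0 W W t x =
      UnboundedOperators.heatExtension (oseenDuhamel 1 0 W W s) (t - s) x + oseenDuhamel 1 s W W t x := by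
    have h1 := oseenDuhamel_eq_setIntegral_add_oseenDuhamel one_pos hWm hWU hs0 hst x
    have h2 := heatExtension_oseenDuhamel_eq_setIntegral one_pos hWm hWU hs0 hst x
    rw [one_mul] at h2
    rw [h1, h2]
  -- the heat semigroup for `V 0`
  have hV0c : Continuous (V 0) := continuous_slice_of_continuousOn_slab hVc ⟨le_rfl, hT.le⟩
  have hV0U : ∀ z, ‖V 0 z‖ ≤ U := fun z => hVU 0 ⟨le_rfl, hT.le⟩ z
  have hsemi : heatFlow (V 0) t x = UnboundedOperators.heatExtension (heatFlow (V 0) s) (t - s) x := by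
    rw [heatFlow_of_pos _ ht0, heatFlow_of_pos _ hs0,
      UnboundedOperators.heatExtension_add_holds (UnboundedOperators.memLp_top_of_continuous_of_bound hV0c hV0U) le_top hs0 hts,
      show s + (t - s) = t by ring]
  -- linearity at time `s`: `V s = (heatFlow V0 s − B₀ s) + D₀ s`
  obtain ⟨CB, hCB0, hCB⟩ := exists_norm_oseenDuhamel_slab_le hT hU hVU
  have hsT : s ∈ Ioc (0:ℝ) T := ⟨hs0, hst.le.trans htT⟩
  have hHc : Continuous (heatFlow (V 0) s) := by
    rw [heatFlow_of_pos _ hs0]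
    exact (UnboundedOperators.contDiff_heatExtension_of_bound (m := 0) hV0c hV0U hs0).continuous
  have hHU : ∀ z, ‖heatFlow (V 0) s z‖ ≤ U := fun z => by
    rw [heatFlow_of_pos _ hs0]; exact UnboundedOperators.norm_heatExtension_le hV0U hs0 z
  have hBc : Continuous (oseenDuhamel 1 0 V V s) := continuous_oseenDuhamel_slab hVc hU hVU hsT
  have hBU : ∀ z, ‖oseenDuhamel 1 0 V V s z‖ ≤ CB := fun z => hCB s hsT z
  have hDc : Continuous (mildDefect V s) := continuous_mildDefect_slice hVc hU hVU hsT
  have hDU : ∀ z, ‖mildDefect V s z‖ ≤ U + U + CB := fun z => by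
    have : mildDefect V s z = V s z - heatFlow (V 0) s z + oseenDuhamel 1 0 V V s z := rfl
    rw [this]
    calc ‖V s z - heatFlow (V 0) s z + oseenDuhamel 1 0 V V s z‖
        ≤ ‖V s z - heatFlow (V 0) s z‖ + ‖oseenDuhamel 1 0 V V s z‖ := norm_add_le _ _
      _ ≤ (‖V s z‖ + ‖heatFlow (V 0) s z‖) + CB := add_le_add (norm_sub_le _ _) (hBU z)
      _ ≤ U + U + CB := by linarith [hVU s ⟨hs0.le, hst.le.trans htT⟩ z, hHU z]
  set g : EuclideanSpace ℝ (Fin 3) → EuclideanSpace ℝ (Fin 3) :=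
    fun z => heatFlow (V 0) s z - oseenDuhamel 1 0 V V s z with hg
  have hgc : Continuous g := hHc.sub hBc
  have hgU : ∀ z, ‖g z‖ ≤ U + CB := fun z => (norm_sub_le _ _).trans (add_le_add (hHU z) (hBU z))
  have hVs : V s = fun z => g z + mildDefect V s z := by
    funext z
    have e1 : mildDefect V s z = V s z - heatFlow (V 0) s z + oseenDuhamel 1 0 V V s z := rfl
    have e2 : g z = heatFlow (V 0) s z - oseenDuhamel 1 0 V V s z := rfl
    rw [e1, e2]; abel
  have hlin : UnboundedOperators.heatExtension (V s) (t - s) x =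
      UnboundedOperators.heatExtension (heatFlow (V 0) s) (t - s) x -
        UnboundedOperators.heatExtension (oseenDuhamel 1 0 V V s) (t - s) x +
        UnboundedOperators.heatExtension (mildDefect V s) (t - s) x := by
    rw [hVs, UnboundedOperators.heatExtension_add_of_bound hgc hDc hgU hDU hts, hg,
      UnboundedOperators.heatExtension_sub_of_bound hHc hBc hHU hBU hts]
  -- assemble
  have hB0t : oseenDuhamel 1 0 V V t x =
      UnboundedOperators.heatExtension (oseenDuhamel 1 0 V V s) (t - s) x + oseenDuhamel 1 s V V t x := by
    rw [hB0W t ⟨ht0, htT⟩ x, hrestart, hBsW x]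
    congr 1
    exact congrArg (fun f => UnboundedOperators.heatExtension f (t - s) x) (funext fun y => (hB0W s hsT y).symm)
  have hDt : mildDefect V t x = V t x - heatFlow (V 0) t x + oseenDuhamel 1 0 V V t x := rfl
  rw [heatFlow_of_pos (V s) hts, heatFlow_of_pos (mildDefect V s) hts, hlin, hDt, hsemi, hB0t]
  abel

/-- **The defect from every base time is at most twice the defect from `0`.** [folklore] -/
theorem norm_mildDefect_restart_le (hD : ∀ t ∈ Icc 0 T, ∀ x, ‖mildDefect V t x‖ ≤ η)
    {s t : ℝ} (hs : 0 ≤ s) (hst : s < t) (htT : t ≤ T) (x : EuclideanSpace ℝ (Fin 3)) :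
    ‖mildDefect V t x - heatFlow (mildDefect V s) (t - s) x‖ ≤ 2 * η := by
  have h1 : ‖mildDefect V t x‖ ≤ η := hD t ⟨hs.trans hst.le, htT⟩ x
  have h2 : ‖heatFlow (mildDefect V s) (t - s) x‖ ≤ η := by
    rw [heatFlow_of_pos _ (sub_pos.2 hst)]
    exact UnboundedOperators.norm_heatExtension_le (fun z => hD s ⟨hs, hst.le.trans htT⟩ z) (sub_pos.2 hst) x
  calc ‖mildDefect V t x - heatFlow (mildDefect V s) (t - s) x‖
      ≤ ‖mildDefect V t x‖ + ‖heatFlow (mildDefect V s) (t - s) x‖ := norm_sub_le _ _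
    _ ≤ 2 * η := by linarith

end Summit.NavierStokesRegularity.NavierStokesRegularity.Cruxes.TypeIQuantSubcubicExp.QuietCollar

end
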